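import Mathlib.Tactic.Linarith
import Summits.CriticalPhenomena.PercolationContinuityZ3.Theorems.PercNearOneGluingNoHeavyLowerTailSahiCTCDownLYM
import HarnessLib

/-!
# `NoHeavyLowerTail` (crux stmt-CriticalPhenomena-4575), P3 lane: the LADDER form at co-level 2 — the split `L₂ = Θ₁·A + e₂·B`,
# the level-2 local weighted LYM lemma `A ≥ 0`, and `L₂ ∈ ℕ[s]` for NESTED all-live pairs (every finite type)

Support file (seat `prim-l12-p3`, gen 24; `--supports stmt-CriticalPhenomena-4575`).  Memo `run/shared/lean/prim/prim-l12/FROM-prim-l12-p3-g24-VALUE-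
LEVEL-TH2K.md` §5.5–5.7.  Vocabulary of `…SahiCTCForms` / `…SahiCTCGenFun`: `gf`, `PiP = Π`, `Th1 = Θ₁` (sets of size ≤ 1), `ee k = e_k`, `bySize`.

THE LADDER CONJECTURE (memo §5.5), level `t = 2`, in the open-set language: for up-sets `𝒳, 𝒵 ⊆ 2^α` all of whose members have size `≥ 2`
("all-live") and `W₂ = 𝒳 ∩ 𝒵 ∩ (α choose 2)` their common 2-sets,
    `L₂(𝒳,𝒵) := e₂·(Π·GF(𝒳∩𝒵) − GF(𝒳)·GF(𝒵)) − Θ₁·e_{≥2}·GF(W₂) ∈ ℕ[s]`      (`e_{≥2} = Π − Θ₁ = GF(sets of size ≥ 2)`),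
value form `Cov(𝒳,𝒵) ≥ Var(1_{≥2 open})·μ₂(W₂)`, equality at `𝒳 = 𝒵 = {all sets of size ≥ 2}`; it implies the (TC) row of the slot "at least two of k
open" for all-live pairs (`M₂ = Π·L₂ + e₂Θ₁·Harris`).  Exact evidence: 0 failures for all 6 441 all-live pairs at `|α| = 4`, random pairs up to `|α| = 9`.
This file proves:
* `PiP_eq_Th1_add_gf_atLeastTwo` : `Π = Θ₁ + GF(sets of size ≥ 2)` (levels via `…SahiCTCDownLYM.gf_eq_sum_levels`);
* `ladder_two_split` : the identity **`L₂ = Θ₁·A + e₂·B`** with `A = e₂·GF(𝒴) − e_{≥2}·GF(𝒴₂)` (`𝒴 = 𝒳 ∩ 𝒵`) and `B = e_{≥2}·GF(𝒴) − GF(𝒳)·GF(𝒵)`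
  (every pair of families);
* `coeff_levelTwoLYM_nonneg` : **`A ≥ 0` coefficientwise** for every up-set `𝒰` with all members of size ≥ 2 — the sum over levels `j ≥ 2` of the tree's
  weighted LYM `e_j·GF(𝒰₂) ≤ e₂·GF(𝒰_j)` (`SahiCTCGenFun.coeff_weightedLYM`);
* `coeff_ladder_two_nonneg_of_subset` (+ `'`) : **`L₂(𝒳,𝒵) ∈ ℕ[s]` whenever `𝒳 ⊆ 𝒵` (or `𝒵 ⊆ 𝒳`)**, `𝒳` (resp. `𝒵`) an up-set and both all-live:
  then `B = GF(𝒳)·GF({≥2}-sets ∖ 𝒵) ≥ 0`.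
What remains of the conjecture (memo §5.7) is the compensation `Θ₁·A ≥ e₂·B⁻` for non-nested pairs (`B = GF(𝒴)·N₂ − GF(𝒳∖𝒵)·GF(𝒵∖𝒳)` can be
negative).  Nothing is asserted about the crux.
-/

namespace Summit.CriticalPhenomena.PercolationContinuityZ3.Theorems.SahiCTCForms

open Finset MvPolynomial SahiCTCGenFun

variable {α : Type*} [DecidableEq α] [Fintype α]

/-! ### Bookkeeping: levels, `Π = Θ₁ + e_{≥2}` -/

omit [Fintype α] in
/-- `GF(F.filter p) + GF(F.filter ¬p) = GF(F)`. [this work] -/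
theorem gf_filter_add_gf_filter_not (F : Finset (Finset α)) (p : Finset α → Prop) [DecidablePred p] :
    gf (F.filter p) + gf (F.filter fun S => ¬ p S) = gf F := by
  rw [← gf_union (disjoint_filter_filter_not F F p), filter_union_filter_not_eq]

/-- `Π = Θ₁ + GF(sets of size ≥ 2)`. [this work] -/
theorem PiP_eq_Th1_add_gf_atLeastTwo :
    (PiP : MvPolynomial α ℤ) = Th1 + gf (bySize (2 ≤ ·) : Finset (Finset α)) := by
  unfold PiP Th1 bySize
  have h : (univ.powerset.filter fun S : Finset α => ¬ (#S ≤ 1)) = univ.powerset.filter fun S : Finset α => 2 ≤ #S := by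
    ext S; simp only [mem_filter, not_le]; constructor <;> rintro ⟨h1, h2⟩ <;> exact ⟨h1, by omega⟩
  rw [← gf_filter_add_gf_filter_not univ.powerset (fun S : Finset α => #S ≤ 1), h]

omit [DecidableEq α] in
/-- The level-`j` part of `{S : 2 ≤ #S}` is `{S : #S = j}` for `j ≥ 2` and empty otherwise. [this work] -/
theorem bySize_atLeastTwo_filter_eq (j : ℕ) :
    ((bySize (2 ≤ ·) : Finset (Finset α)).filter fun S => #S = j) =
      if 2 ≤ j then (univ.powerset.filter fun S : Finset α => #S = j) else ∅ := by
  unfold bySize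
  split_ifs with hj
  · ext S; simp only [mem_filter]; constructor
    · rintro ⟨⟨h1, _⟩, h3⟩; exact ⟨h1, h3⟩
    · rintro ⟨h1, h3⟩; exact ⟨⟨h1, by omega⟩, h3⟩
  · refine filter_eq_empty_iff.2 fun S hS h => hj ?_
    have := (mem_filter.1 hS).2; omega

/-! ### The split `L₂ = Θ₁·A + e₂·B` -/

/-- **The split of the ladder form**: for any families `𝒳, 𝒵` and any `W`,
`e₂·(Π·GF(𝒳∩𝒵) − GF(𝒳)GF(𝒵)) − Θ₁·e_{≥2}·GF(W) = Θ₁·(e₂·GF(𝒳∩𝒵) − e_{≥2}·GF(W)) + e₂·(e_{≥2}·GF(𝒳∩𝒵) − GF(𝒳)GF(𝒵))`. [this work] -/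
theorem ladder_two_split (𝒳 𝒵 W : Finset (Finset α)) :
    ee 2 * (PiP * gf (𝒳 ∩ 𝒵) - gf 𝒳 * gf 𝒵) - Th1 * gf (bySize (2 ≤ ·) : Finset (Finset α)) * gf W =
      Th1 * (ee 2 * gf (𝒳 ∩ 𝒵) - gf (bySize (2 ≤ ·) : Finset (Finset α)) * gf W) +
        ee 2 * (gf (bySize (2 ≤ ·) : Finset (Finset α)) * gf (𝒳 ∩ 𝒵) - gf 𝒳 * gf 𝒵) := by
  rw [PiP_eq_Th1_add_gf_atLeastTwo]; ring

/-! ### `A ≥ 0`: the level-2 local weighted LYM lemma -/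

/-- **`e₂·GF(𝒰) − e_{≥2}·GF(𝒰₂) ∈ ℕ[s]`** for every up-set `𝒰` all of whose members have size `≥ 2` (`𝒰₂` = its 2-element members): summing the
weighted LYM inequalities `e_j·GF(𝒰₂) ≤ e₂·GF(𝒰_j)` over the levels `j ≥ 2`.  Equality for `𝒰 = {all sets of size ≥ 2}`. [this work] -/
theorem coeff_levelTwoLYM_nonneg {𝒰 : Finset (Finset α)} (h𝒰 : IsUpperSet (𝒰 : Set (Finset α))) (hlive : ∀ S ∈ 𝒰, 2 ≤ #S)
    (n : α →₀ ℕ) :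
    0 ≤ (ee 2 * gf 𝒰 - gf (bySize (2 ≤ ·) : Finset (Finset α)) * gf (𝒰.filter fun S => #S = 2)).coeff n := by
  have hsum : ee 2 * gf 𝒰 - gf (bySize (2 ≤ ·) : Finset (Finset α)) * gf (𝒰.filter fun S => #S = 2) =
      ∑ j ∈ range (Fintype.card α + 1),
        (ee 2 * gf (𝒰.filter fun S => #S = j) - gf ((bySize (2 ≤ ·) : Finset (Finset α)).filter fun S => #S = j) *
          gf (𝒰.filter fun S => #S = 2)) := by
    rw [sum_sub_distrib, ← mul_sum, ← sum_mul, ← gf_eq_sum_levels, ← gf_eq_sum_levels]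
  rw [hsum, coeff_sum]
  refine sum_nonneg fun j _ => ?_
  rw [bySize_atLeastTwo_filter_eq]
  split_ifs with hj
  · unfold ee bySize
    exact coeff_weightedLYM_sub_nonneg h𝒰 hj n
  · -- j ≤ 1: the level is empty on both sides
    have hempty : (𝒰.filter fun S => #S = j) = ∅ :=
      filter_eq_empty_iff.2 fun S hS h => hj (by have := hlive S hS; omega)
    rw [hempty]
    simp [gf]

/-! ### `L₂ ∈ ℕ[s]` for nested all-live pairs -/

/-- For an all-live family `𝒵` (all members of size ≥ 2): `GF({S : 2 ≤ #S}) − GF(𝒵) = GF({S : 2 ≤ #S} ∖ 𝒵)`. [this work] -/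
theorem gf_atLeastTwo_sub_eq {𝒵 : Finset (Finset α)} (hlive : ∀ S ∈ 𝒵, 2 ≤ #S) :
    gf (bySize (2 ≤ ·) : Finset (Finset α)) - gf 𝒵 = gf ((bySize (2 ≤ ·) : Finset (Finset α)) \ 𝒵) := by
  have hsub : 𝒵 ⊆ (bySize (2 ≤ ·) : Finset (Finset α)) := fun S hS => by
    unfold bySize; exact mem_filter.2 ⟨mem_powerset.2 (subset_univ _), hlive S hS⟩
  rw [sub_eq_iff_eq_add, ← gf_union sdiff_disjoint, sdiff_union_of_subset hsub]

/-- **The ladder form `L₂` has nonnegative coefficients for NESTED all-live pairs `𝒳 ⊆ 𝒵`** (`𝒳` an up-set; all members of `𝒳, 𝒵` of size ≥ 2):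
`e₂·(Π·GF(𝒳∩𝒵) − GF(𝒳)GF(𝒵)) − Θ₁·e_{≥2}·GF((𝒳∩𝒵)₂) ∈ ℕ[s]`.  Proof: `L₂ = Θ₁·A + e₂·GF(𝒳)·GF({≥2}-sets ∖ 𝒵)`. [this work] -/
theorem coeff_ladder_two_nonneg_of_subset {𝒳 𝒵 : Finset (Finset α)} (h𝒳 : IsUpperSet (𝒳 : Set (Finset α)))
    (hlive𝒳 : ∀ S ∈ 𝒳, 2 ≤ #S) (hlive𝒵 : ∀ S ∈ 𝒵, 2 ≤ #S) (hsub : 𝒳 ⊆ 𝒵) (n : α →₀ ℕ) :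
    0 ≤ (ee 2 * (PiP * gf (𝒳 ∩ 𝒵) - gf 𝒳 * gf 𝒵) -
      Th1 * gf (bySize (2 ≤ ·) : Finset (Finset α)) * gf ((𝒳 ∩ 𝒵).filter fun S => #S = 2)).coeff n := by
  rw [ladder_two_split, inter_eq_left.2 hsub]
  have hB : gf (bySize (2 ≤ ·) : Finset (Finset α)) * gf 𝒳 - gf 𝒳 * gf 𝒵 =
      gf 𝒳 * gf ((bySize (2 ≤ ·) : Finset (Finset α)) \ 𝒵) := by
    rw [← gf_atLeastTwo_sub_eq hlive𝒵]; ring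
  rw [hB, coeff_add]
  refine add_nonneg ?_ ?_
  · exact coeff_mul_nonneg (fun m => by unfold Th1; exact coeff_gf_nonneg _ m) (coeff_levelTwoLYM_nonneg h𝒳 hlive𝒳) n
  · exact coeff_mul_nonneg (fun m => by unfold ee; exact coeff_gf_nonneg _ m)
      (fun m => coeff_mul_nonneg (coeff_gf_nonneg _) (coeff_gf_nonneg _) m) n

/-- The same for `𝒵 ⊆ 𝒳` (`𝒵` an up-set), by symmetry of `L₂`. [this work] -/
theorem coeff_ladder_two_nonneg_of_subset' {𝒳 𝒵 : Finset (Finset α)} (h𝒵 : IsUpperSet (𝒵 : Set (Finset α)))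
    (hlive𝒳 : ∀ S ∈ 𝒳, 2 ≤ #S) (hlive𝒵 : ∀ S ∈ 𝒵, 2 ≤ #S) (hsub : 𝒵 ⊆ 𝒳) (n : α →₀ ℕ) :
    0 ≤ (ee 2 * (PiP * gf (𝒳 ∩ 𝒵) - gf 𝒳 * gf 𝒵) -
      Th1 * gf (bySize (2 ≤ ·) : Finset (Finset α)) * gf ((𝒳 ∩ 𝒵).filter fun S => #S = 2)).coeff n := by
  have h := coeff_ladder_two_nonneg_of_subset h𝒵 hlive𝒵 hlive𝒳 hsub n
  rw [inter_comm 𝒵 𝒳, mul_comm (gf 𝒵) (gf 𝒳)] at h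
  exact h

/-- `e_{≥2} = Π − Θ₁`, so the ladder form can be written with `PiP - Th1`: nested case restated. [this work] -/
theorem coeff_ladder_two_nonneg_of_subset_PiP {𝒳 𝒵 : Finset (Finset α)} (h𝒳 : IsUpperSet (𝒳 : Set (Finset α)))
    (hlive𝒳 : ∀ S ∈ 𝒳, 2 ≤ #S) (hlive𝒵 : ∀ S ∈ 𝒵, 2 ≤ #S) (hsub : 𝒳 ⊆ 𝒵) (n : α →₀ ℕ) :
    0 ≤ (ee 2 * (PiP * gf (𝒳 ∩ 𝒵) - gf 𝒳 * gf 𝒵) -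
      Th1 * (PiP - Th1) * gf ((𝒳 ∩ 𝒵).filter fun S => #S = 2)).coeff n := by
  have h : (PiP : MvPolynomial α ℤ) - Th1 = gf (bySize (2 ≤ ·) : Finset (Finset α)) := by
    rw [PiP_eq_Th1_add_gf_atLeastTwo]; ring
  rw [h]; exact coeff_ladder_two_nonneg_of_subset h𝒳 hlive𝒳 hlive𝒵 hsub n

end Summit.CriticalPhenomena.PercolationContinuityZ3.Theorems.SahiCTCForms
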